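import Literature.MathematicalPhysics.QuantumFieldTheory.Balaban1983to89.Beta.BalabanCompositeJets
import Summits.QuantumFields.BalabanUV.Beta.FP.PerfectObjects

/-!
# `BalabanUV.Beta.FP.StationarityJ` — road «FP» for binder row D1, leaf N1-J (FINITE LEVEL): the DECIMATED-COMPOSITE first-order
# stencil family of the (j, m)-systems and its EXACT NESTING under one more blocking step — decimation of the fluctuation legs (an4's
# `dec`, as for `PerfectObjects.KTot`) COMPOSED WITH the transport of the background-bond index through the one-step minimiser
# response (an2's `transportV` / `respStep`, i.e. (K1b′) at the vertex level, `BalabanCompositeJets.vertexOf_pow_succ` BY NAME)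

HONEST FRAMING (cell contract, verbatim): «discharging `BetaPertH` makes Bałaban's UV stability UNCONDITIONAL — a real constructive-QFT
result; it is NOT the continuum limit and NOT the Clay problem.»  THIS MODULE DISCHARGES NOTHING: two definitions-by-abbreviation over the
cell's typed `U = 1` objects (`OneStepKernelFamily.dec`, `OneStepResolventKernel.vertexOf`, `BalabanCompositeJets.Sc`) and finite-sum /
absolutely-convergent-sum bookkeeping; the one non-trivial input is an2's kernel theorem `BalabanCompositeJets.vertexOf_pow_succ` ((K1b′) =
an5's `ResolventComposition.wH_reproduction` at the vertex level), imported BY NAME.  Skeleton `HOME/beta/skeletons/D1-b2b-balaban-beta-d1-p3.md`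
§3 N1 («Jets: the same with the (j, m) constructors' nesting … an2 `InterLevelTransport`»), design note `HOME/b2b-balaban-beta-d1-p3/JETS-JM-DESIGN.md`
§1/§1a, claim table `LEAVES-FP.md` row N1-J (unit `b2b-balaban-beta-d1-formalise-leaf-08`).  NOT BetaPertH, NOT continuum, NOT Clay.
HONEST DEPENDENCY (verbatim): «continuum YM on T⁴ ⇐ BetaPertH ∧ nine spine estimates (0/9 proved); BetaPertH ⇐ (D1) ∧ (D4) ∧ CAP+tail;
G-an2-4 gates asym, D1 and NE2/3/4.»
ABSOLUTE RULE (cell, verbatim): «No internally-minted statement may enter as a cited fact. Every hypothesis is either kernel-proved in this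
package or a verbatim quotation of a PUBLISHED theorem with page reference.»  Nothing is cited; no `def … : Prop`; no binder instantiated.

## The object, and why the bond index must be transported (our design finding, recorded for the row owner)

Road FP's perfect objects (`FP/PerfectObjectsT`) read a (j, m)-indexed first-order family `S j m κ u` through `axVertexOfK (KTot …) (Lc^m) (S j m)`,
whose weighted sum runs over the bond index `u` AGAINST THE ℋ-COLUMN OF THE (j, m)-RESOLVENT `KTot (Lc^(j+m)) (Lc^j)` — a kernel on the
STEP-`j` LATTICE (`dec`'s output index).  So `u` must be a step-`j` bond.  an2's composite stencil `Sc n κ u` (the `(n+1)`-fold one-shot stencil)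
is indexed by FINE (level-0) bonds `u` (`locStencil_Sc`: bi-localised at `u` on the fine lattice); decimating only its fluctuation legs
(`fun κ u => dec (Lc^j) (Sc … κ u)`, the letter of JETS-JM-DESIGN §1a) leaves `u` fine — a type-correct but MIS-INDEXED family (its `u`-sum
against `KTot`'s step-`j` column pairs two different lattices).  The step-`j`-indexed object is obtained exactly as an2's own value-function
jets `BalabanStepJetsSucc.e3Of j` obtain theirs: by the CHAIN RULE THROUGH THE `j`-FOLD MINIMISER, `OneStepResolventKernel.vertexOf (N := Lc^j)`
(`Σ_{κ′} Σ'_{u′ fine} ℋ_{Lc^j}(κ′,u′; κ, u)·Sc … κ′ u′`, the response of the fine bond `(κ′,u′)` to the step-`j` background bond `(κ, u)`),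
THEN decimation of the fluctuation legs.  Hence the family of this file (member `m` ↔ the `(m+1)`-fold step on the step-`j` system, so that
member `0` sits in the wall's `m = 1` slot):
  `SDec j m κ u := (Lc^j)^{d+2} • dec (Lc^j) (vertexOf (N := Lc^j) (Sc … (j + m)) κ u)`
(sum normalisation `(Lc^j)^{d+2}` = the one of `BalabanCompositeJets.respStep_eq`; at `j = 0` the family is `Sc` itself — `SDec_zero_level`, §4 (v2)).

## What is proved (all [folklore] / [our object]; general `d`, `Lc ≥ 1`)

* §1 ALGEBRA OF `dec` (an4's block-contour decimation is a finite weighted sum of entries): `dec_add`, `dec_smul`, `dec_fun_sum` (finite sums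
  of kernel families), `dec_apply_tsum` (an entrywise absolutely convergent superposition, under SUMMABILITY), whence `dec_cwsum` and
  **`dec_transportV`** — decimation of the fluctuation legs COMMUTES with an2's response transport of the bond index (they act on different
  indices); `transportV_smul`; `decS` (decimation of every member of a stencil family) and its nesting `decS_decS` (`ScaleNesting.dec_dec`).
* §2 `summable_respStep_mul_vertexOf` — the transport superposition of a one-shot chain-rule vertex family is absolutely convergent
  (`summable_respStep` × the uniform entry bound of `vertexFamily_vertexOf'`).
* §4 (v2) THE BASE: `vertexOf_of_eq_one` (`ℋ_1 = 𝟙` ⇒ the chain rule at blocking `1` is the identity, `ResolventComposition.wH_one`) and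
  **`SDec_zero_level : SDec … 0 m = Sc … m`** — at `j = 0` the family IS an2's composite family (`dec_one`), so the indexing is certified at the base.
* §3 THE FAMILY `SDec` and **`SDec_succ_level` (N1-J AT FINITE LEVEL, EXACT)**:
  `SDec (j+1) m κ u = Lc^{d+2} • transportV (Lc^j) (respStep (Lc^j) (Lc^(j+1))) (decS Lc (SDec j (m+1))) κ u`
  — passing from the step-`j` to the step-`(j+1)` description of the SAME composite system is: decimate the fluctuation legs once more
  (`dec Lc`, nesting `dec_dec`) AND drive the bond index through the one-step minimiser response `respStep (Lc^j) (Lc^(j+1))`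
  (= `(Lc^j)^{d+2}·KInvStep Lc j`, an4's `wStep` weight; `respStep_eq` / `respStep_eq_wStep`), by (K1b′) `vertexOf_pow_succ`.  This is the
  stencil twin of `PerfectObjects.KTot_shift`; the K-half had no index to transport.
WHAT IS NOT DONE HERE (recorded): (a) the passage `j → ∞` (row N1-J, limit half: the transport weights must converge together with the
stencils — X1/X1m currency — and the coarse superposition commutes with entrywise limits by dominated convergence, `FP/TransportLimit`
pattern); (b) the m = 1 PIN against the wall family: `SDec j 0` is NOT an2's `BalabanStepJetsSucc.Sstep j` as a stencil (that one is built
from the VALUE-FUNCTION jets `e3Of`/`E2` with `mmRead`); their agreement at the level of the induced one-loop kernels / second moments is (a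
form of) the cell's open recursion identity (R1) — the road's END `FP/RoadEnd.d1Drift_JsBalOf_of_rate_step_law_*` only needs the NUMBER pin
`g 1 = secondMoment T∞ μ ν`, so the owner may re-pose `PerfectObjectsT`'s stencil-level `hS1` accordingly; nothing of (R1) is asserted here;
(c) second-order tables (the `transportW`/`vertex2Of` twin, (K1b′ ⊗ K1b′) `vertex2Of_eq_transportW`) — same pattern, not typed here.
-/

namespace Summit.QuantumFields.BalabanUV.Beta.FP.StationarityJ

open Finset
open scoped BigOperators
open Literature.MathematicalPhysics.QuantumFieldTheory.Balaban1983to89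
open Literature.MathematicalPhysics.QuantumFieldTheory.Balaban1983to89.Beta
open Literature.MathematicalPhysics.QuantumFieldTheory.Balaban1983to89.B12Sec2to5 (l1 l1_nonneg)
open ExpKernelCalculus (MKer BiLoc VertexFamily)
open OneStepResolventKernel (Fib LocStencil vertexOf vertexFamily_vertexOf')
open OneStepKernelFamily (dec legSet legPt legW)
open InterLevelTransport (cwsum cwsum_apply transportV)
open BalabanCompositeJets (Sc locStencil_Sc respStep summable_respStep vertexOf_pow_succ)
open Summit.QuantumFields.BalabanUV.Beta.GAN24.ScaleNesting (dec_dec dec_dec')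

variable {d : ℕ}

/-! ## §1 Algebra of the block-contour decimation `dec`; decimated stencil families -/

section DecAlgebra

/-- [folklore] Unfolding of an entry of `dec M K`. -/
theorem dec_apply (M : ℕ) (K : MKer (d + 1) (Fib d)) (x' y' : Fin (d + 1) → ℤ) (a b : Fib d) :
    dec M K x' y' a b = ∑ i ∈ legSet d M a, ∑ i' ∈ legSet d M b, legW d M a * legW d M b * K (legPt M a x' i) (legPt M b y' i') a b :=
  rfl

/-- [folklore] `dec` is additive. -/
theorem dec_add (M : ℕ) (K K' : MKer (d + 1) (Fib d)) : dec M (K + K') = dec M K + dec M K' := by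
  funext x' y' a b
  simp only [dec_apply, Pi.add_apply, mul_add, Finset.sum_add_distrib]

/-- [folklore] `dec` commutes with scalars. -/
theorem dec_smul (M : ℕ) (c : ℝ) (K : MKer (d + 1) (Fib d)) : dec M (c • K) = c • dec M K := by
  funext x' y' a b
  simp only [dec_apply, Pi.smul_apply, smul_eq_mul, Finset.mul_sum]
  exact Finset.sum_congr rfl fun i _ => Finset.sum_congr rfl fun i' _ => by ring

/-- [folklore] `dec` commutes with finite sums of kernel families (written entrywise). -/
theorem dec_fun_sum {ι : Type*} (M : ℕ) (s : Finset ι) (G : ι → MKer (d + 1) (Fib d)) :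
    dec M (fun x w a b => ∑ t ∈ s, G t x w a b) = fun x w a b => ∑ t ∈ s, dec M (G t) x w a b := by
  funext x' y' a b
  simp only [dec_apply, Finset.mul_sum]
  calc ∑ i ∈ legSet d M a, ∑ i' ∈ legSet d M b, ∑ t ∈ s, legW d M a * legW d M b * G t (legPt M a x' i) (legPt M b y' i') a b
      = ∑ i ∈ legSet d M a, ∑ t ∈ s, ∑ i' ∈ legSet d M b, legW d M a * legW d M b * G t (legPt M a x' i) (legPt M b y' i') a b :=
        Finset.sum_congr rfl fun i _ => Finset.sum_comm
    _ = ∑ t ∈ s, ∑ i ∈ legSet d M a, ∑ i' ∈ legSet d M b, legW d M a * legW d M b * G t (legPt M a x' i) (legPt M b y' i') a b :=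
        Finset.sum_comm

/-- [folklore] **`dec` THROUGH AN ABSOLUTELY CONVERGENT SUPERPOSITION**: if every entry of `F` is the sum `Σ'_y (f y)(entry)` of a family
with summable entries, then every entry of `dec M F` is `Σ'_y (dec M (f y))(entry)` (finite weighted sums commute with `tsum`). -/
theorem dec_apply_tsum (M : ℕ) {ι : Type*} {f : ι → MKer (d + 1) (Fib d)} {F : MKer (d + 1) (Fib d)}
    (hF : ∀ p q a b, F p q a b = ∑' y, f y p q a b) (hsum : ∀ p q a b, Summable fun y => f y p q a b)
    (x' y' : Fin (d + 1) → ℤ) (a b : Fib d) :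
    dec M F x' y' a b = ∑' y, dec M (f y) x' y' a b := by
  simp only [dec_apply, hF]
  have h1 : ∀ i ∈ legSet d M a, Summable fun y => ∑ i' ∈ legSet d M b,
      legW d M a * legW d M b * f y (legPt M a x' i) (legPt M b y' i') a b :=
    fun i _ => summable_sum fun i' _ => (hsum _ _ a b).mul_left _
  rw [Summable.tsum_finsetSum (f := fun i y => ∑ i' ∈ legSet d M b,
      legW d M a * legW d M b * f y (legPt M a x' i) (legPt M b y' i') a b) h1]
  refine Finset.sum_congr rfl fun i _ => ?_
  rw [Summable.tsum_finsetSum (f := fun i' y => legW d M a * legW d M b * f y (legPt M a x' i) (legPt M b y' i') a b)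
    (fun i' _ => (hsum _ _ a b).mul_left _)]
  refine Finset.sum_congr rfl fun i' _ => ?_
  exact (tsum_mul_left).symm

/-- [folklore] `dec` through an2's coarse-indexed superposition `cwsum` (under summability of the superposition). -/
theorem dec_cwsum {N : ℕ} [NeZero N] (M : ℕ) {w : (Fin (d + 1) → ℤ) → ℝ} {Q : (Fin (d + 1) → ℤ) → MKer (d + 1) (Fib d)}
    (hsum : ∀ p q a b, Summable fun y => w y * Q y p q a b) :
    dec M (cwsum N w Q) = cwsum N w (fun y => dec M (Q y)) := by
  have hF : ∀ p q a b, cwsum N w Q p q a b = ∑' y, (w y • Q y) p q a b := fun p q a b => by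
    simpa only [Pi.smul_apply, smul_eq_mul] using cwsum_apply w Q p q a b
  have hsum' : ∀ p q a b, Summable fun y => (w y • Q y) p q a b := fun p q a b => by
    simpa only [Pi.smul_apply, smul_eq_mul] using hsum p q a b
  funext x' y' a b
  rw [cwsum_apply, dec_apply_tsum M hF hsum']
  exact tsum_congr fun y => by rw [dec_smul]; rfl

/-- [folklore] **DECIMATION COMMUTES WITH THE RESPONSE TRANSPORT OF THE BOND INDEX** (an2's `InterLevelTransport.transportV`): the two
operations act on different indices (fluctuation legs / background bond), provided the transport superposition converges absolutely. -/
theorem dec_transportV {N : ℕ} [NeZero N] (M : ℕ) {R : Fin (d + 1) → (Fin (d + 1) → ℤ) → Fin (d + 1) → (Fin (d + 1) → ℤ) → ℝ}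
    {𝒱 : Fin (d + 1) → (Fin (d + 1) → ℤ) → MKer (d + 1) (Fib d)}
    (hsum : ∀ μ z μ' p q a b, Summable fun y' => R μ z μ' y' * 𝒱 μ' y' p q a b) (μ : Fin (d + 1)) (z : Fin (d + 1) → ℤ) :
    dec M (transportV N R 𝒱 μ z) = transportV N R (fun μ' y' => dec M (𝒱 μ' y')) μ z := by
  have e : transportV N R 𝒱 μ z = fun x w a b => ∑ μ' ∈ (Finset.univ : Finset (Fin (d + 1))),
      cwsum N (fun y' => R μ z μ' y') (𝒱 μ') x w a b := rfl
  rw [e, dec_fun_sum]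
  funext x' y' a b
  show ∑ μ' : Fin (d + 1), dec M (cwsum N (fun y' => R μ z μ' y') (𝒱 μ')) x' y' a b = _
  simp only [dec_cwsum M (hsum μ z _)]
  rfl

/-- [folklore] The response transport is linear in the transported family (scalars). -/
theorem transportV_smul {N : ℕ} [NeZero N] (R : Fin (d + 1) → (Fin (d + 1) → ℤ) → Fin (d + 1) → (Fin (d + 1) → ℤ) → ℝ)
    (c : ℝ) (𝒱 : Fin (d + 1) → (Fin (d + 1) → ℤ) → MKer (d + 1) (Fib d)) (μ : Fin (d + 1)) (z : Fin (d + 1) → ℤ) :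
    transportV N R (fun μ' y' => c • 𝒱 μ' y') μ z = c • transportV N R 𝒱 μ z := by
  funext x w a b
  show ∑ μ' : Fin (d + 1), cwsum N (fun y' => R μ z μ' y') (fun y' => c • 𝒱 μ' y') x w a b =
    c * ∑ μ' : Fin (d + 1), cwsum N (fun y' => R μ z μ' y') (𝒱 μ') x w a b
  rw [Finset.mul_sum]
  refine Finset.sum_congr rfl fun μ' _ => ?_
  rw [cwsum_apply, cwsum_apply, ← tsum_mul_left]
  exact tsum_congr fun y' => by simp only [Pi.smul_apply, smul_eq_mul]; ring

/-- [our object] Decimation of EVERY MEMBER of a stencil family (fluctuation legs of `S κ u` block-contour-averaged by `M`, multiplier legs read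
at the coarse points; the bond index `(κ, u)` is NOT touched). -/
noncomputable def decS (M : ℕ) (S : Fin (d + 1) → (Fin (d + 1) → ℤ) → MKer (d + 1) (Fib d)) :
    Fin (d + 1) → (Fin (d + 1) → ℤ) → MKer (d + 1) (Fib d) :=
  fun κ u => dec M (S κ u)

/-- [our object] Unfolding. -/
@[simp] theorem decS_apply (M : ℕ) (S : Fin (d + 1) → (Fin (d + 1) → ℤ) → MKer (d + 1) (Fib d)) (κ : Fin (d + 1))
    (u : Fin (d + 1) → ℤ) : decS M S κ u = dec M (S κ u) := rfl

/-- [folklore] Decimations of stencil families nest (`ScaleNesting.dec_dec` memberwise). -/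
theorem decS_decS (M P : ℕ) (S : Fin (d + 1) → (Fin (d + 1) → ℤ) → MKer (d + 1) (Fib d)) :
    decS P (decS M S) = decS (M * P) S := by
  funext κ u
  exact dec_dec M P (S κ u)

end DecAlgebra

/-! ## §2 The transport superposition of a one-shot chain-rule vertex family converges absolutely -/

section Summability

/-- [folklore] A vertex family has uniformly bounded entries: `|𝒱 μ y x z a b| ≤ Cv`. -/
theorem abs_apply_le_of_vertexFamily {N : ℕ} {𝒱 : Fin (d + 1) → (Fin (d + 1) → ℤ) → MKer (d + 1) (Fib d)} {Cv δv : ℝ}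
    (hV : VertexFamily 𝒱 N Cv δv) (hδv : 0 < δv) (μ : Fin (d + 1)) (y x z : Fin (d + 1) → ℤ) (a b : Fib d) :
    |𝒱 μ y x z a b| ≤ Cv := by
  have hCv : 0 ≤ Cv := (hV μ y).nonneg a
  refine (hV μ y x z a b).trans ?_
  have hexp : Real.exp (-δv * (l1 (x - (N : ℤ) • y) + l1 (z - (N : ℤ) • y))) ≤ 1 := by
    rw [Real.exp_le_one_iff]
    have := l1_nonneg (x - (N : ℤ) • y)
    have := l1_nonneg (z - (N : ℤ) • y)
    nlinarith
  calc Cv * Real.exp (-δv * (l1 (x - (N : ℤ) • y) + l1 (z - (N : ℤ) • y))) ≤ Cv * 1 :=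
        mul_le_mul_of_nonneg_left hexp hCv
    _ = Cv := mul_one Cv

/-- [folklore] **ABSOLUTE CONVERGENCE OF THE TRANSPORT SUPERPOSITION** of the one-shot chain-rule vertex family of a local stencil
family: `y′ ↦ respStep M N′ μ z μ′ y′ · vertexOf S μ′ y′ (entry)` is summable (summable response × bounded vertex entries). -/
theorem summable_respStep_mul_vertexOf {M N' : ℕ} [NeZero M] [NeZero N']
    {S : Fin (d + 1) → (Fin (d + 1) → ℤ) → MKer (d + 1) (Fib d)} {Cs δ : ℝ} (hS : LocStencil S Cs δ) (hδ : 0 < δ)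
    (μ : Fin (d + 1)) (z : Fin (d + 1) → ℤ) (μ' : Fin (d + 1)) (p q : Fin (d + 1) → ℤ) (a b : Fib d) :
    Summable fun y' => respStep (d := d) M N' μ z μ' y' * vertexOf (N := M) S μ' y' p q a b := by
  obtain ⟨Cv, δv, hδv, hV⟩ := vertexFamily_vertexOf' (N := M) hS hδ
  refine Summable.of_norm_bounded ((summable_respStep (d := d) M N' μ z μ').norm.mul_right Cv) fun y' => ?_
  rw [norm_mul, Real.norm_eq_abs, Real.norm_eq_abs]
  exact mul_le_mul_of_nonneg_left (abs_apply_le_of_vertexFamily hV hδv μ' y' p q a b) (abs_nonneg _)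

end Summability

/-! ## §3 The decimated-composite first-order family of the (j, m)-systems and its exact nesting -/

section Family

variable (d) (Lc : ℕ) [NeZero Lc]

/-- [our object] **THE DECIMATED-COMPOSITE FIRST-ORDER FAMILY** of road FP: member `(j, m)` is an2's one-shot stencil of the
`(j+m+1)`-fold composite step (`BalabanCompositeJets.Sc … (j+m)`, fine coordinates), driven through the `j`-fold minimiser response to the
step-`j` background bond `(κ, u)` (`vertexOf (N := Lc^j)`, the chain rule an2's value-function jets use) and with its fluctuation legs
decimated to the step-`j` lattice (`dec (Lc^j)`, as `PerfectObjects.KTot`), in the sum normalisation `(Lc^j)^{d+2}` of `respStep_eq`.  Member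
`m` is the first-order datum of the `(m+1)`-fold step BUILT ON the step-`j` system (READING; header); member `0` sits in the wall's `m = 1` slot. -/
noncomputable def SDec (cE cVH cΛ : ℝ) (j m : ℕ) : Fin (d + 1) → (Fin (d + 1) → ℤ) → MKer (d + 1) (Fib d) :=
  fun κ u => (((Lc ^ j : ℕ) : ℝ) ^ (d + 2)) • dec (Lc ^ j) (vertexOf (N := Lc ^ j) (Sc d Lc cE cVH cΛ (j + m)) κ u)

variable {d Lc}

/-- [our object] Unfolding. -/
theorem SDec_apply (cE cVH cΛ : ℝ) (j m : ℕ) (κ : Fin (d + 1)) (u : Fin (d + 1) → ℤ) :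
    SDec d Lc cE cVH cΛ j m κ u =
      (((Lc ^ j : ℕ) : ℝ) ^ (d + 2)) • dec (Lc ^ j) (vertexOf (N := Lc ^ j) (Sc d Lc cE cVH cΛ (j + m)) κ u) := rfl

/-- [folklore] One more decimation of member `(j, m+1)`, with the normalisation bookkeeping:
`dec Lc (SDec j (m+1) κ u) = (Lc^j)^{d+2} • dec (Lc^(j+1)) (vertexOf (N := Lc^j) (Sc … (j+m+1)) κ u)` (`dec_dec`). -/
theorem dec_SDec_succ (cE cVH cΛ : ℝ) (j m : ℕ) (κ : Fin (d + 1)) (u : Fin (d + 1) → ℤ) :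
    dec Lc (SDec d Lc cE cVH cΛ j (m + 1) κ u) =
      (((Lc ^ j : ℕ) : ℝ) ^ (d + 2)) • dec (Lc ^ (j + 1)) (vertexOf (N := Lc ^ j) (Sc d Lc cE cVH cΛ (j + m + 1)) κ u) := by
  rw [SDec_apply, dec_smul, dec_dec' (pow_succ Lc j)]
  rfl

/-- [folklore] **N1-J AT FINITE LEVEL (EXACT NESTING OF THE DECIMATED-COMPOSITE STENCILS).**  For every `j, m` and every step-`(j+1)`
bond `(κ, u)`:
`SDec (j+1) m κ u = Lc^{d+2} • transportV (Lc^j) (respStep (Lc^j) (Lc^(j+1))) (decS Lc (SDec j (m+1))) κ u`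
— the step-`(j+1)` description of the composite system is obtained from the step-`j` one by ONE MORE DECIMATION of the fluctuation legs
(`dec Lc`) AND THE TRANSPORT OF THE BOND INDEX through the one-step minimiser response `respStep (Lc^j) (Lc^(j+1))`
(`= (Lc^j)^{d+2}·KInvStep Lc j`, `respStep_eq`), by an2's (K1b′)-at-the-vertex-level `vertexOf_pow_succ` and §1. -/
theorem SDec_succ_level (hLc : 1 ≤ Lc) (cE cVH cΛ : ℝ) (j m : ℕ) (κ : Fin (d + 1)) (u : Fin (d + 1) → ℤ) :
    SDec d Lc cE cVH cΛ (j + 1) m κ u =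
      ((Lc : ℝ) ^ (d + 2)) • transportV (Lc ^ j) (respStep (d := d) (Lc ^ j) (Lc ^ (j + 1)))
        (decS Lc (SDec d Lc cE cVH cΛ j (m + 1))) κ u := by
  obtain ⟨Cs, δ, hδ, hS⟩ := locStencil_Sc (d := d) (Lc := Lc) hLc cE cVH cΛ (j + m + 1)
  have hidx : j + 1 + m = j + m + 1 := by omega
  -- the right-hand side: decimate once more and pull the normalisation through the transport
  have hR : (decS Lc (SDec d Lc cE cVH cΛ j (m + 1))) = fun κ' u' =>
      (((Lc ^ j : ℕ) : ℝ) ^ (d + 2)) • dec (Lc ^ (j + 1)) (vertexOf (N := Lc ^ j) (Sc d Lc cE cVH cΛ (j + m + 1)) κ' u') := by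
    funext κ' u'
    exact dec_SDec_succ cE cVH cΛ j m κ' u'
  rw [hR, transportV_smul, smul_smul]
  -- the left-hand side: (K1b′) at the vertex level, then decimation through the transport
  rw [SDec_apply, hidx, vertexOf_pow_succ Lc hS hδ j κ u,
    dec_transportV (Lc ^ (j + 1)) (fun μ z μ' p q a b => summable_respStep_mul_vertexOf hS hδ μ z μ' p q a b) κ u]
  congr 1
  push_cast
  ring

/-- [folklore] The same nesting with the step resolvent displayed: the transport weight is `(Lc^j)^{d+2}·KInvStep Lc j u′ (Lc•u) (inl κ′) (inr κ)`
— an4's `wStep`-type weight (`BalabanCompositeJets.respStep_eq`). -/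
theorem SDec_succ_level_KInvStep (hLc : 1 ≤ Lc) (cE cVH cΛ : ℝ) (j m : ℕ) (κ : Fin (d + 1)) (u : Fin (d + 1) → ℤ) :
    SDec d Lc cE cVH cΛ (j + 1) m κ u =
      ((Lc : ℝ) ^ (d + 2)) • transportV (Lc ^ j)
        (fun μ z l'' w' => (((Lc ^ j : ℕ) : ℝ) ^ (d + 2)) * OneStepKernelFamily.KInvStep (d := d) Lc j w' ((Lc : ℤ) • z) (Sum.inl l'') (Sum.inr μ))
        (decS Lc (SDec d Lc cE cVH cΛ j (m + 1))) κ u := by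
  rw [SDec_succ_level hLc]
  have e : respStep (d := d) (Lc ^ j) (Lc ^ (j + 1)) = fun μ z l'' w' =>
      (((Lc ^ j : ℕ) : ℝ) ^ (d + 2)) * OneStepKernelFamily.KInvStep (d := d) Lc j w' ((Lc : ℤ) • z) (Sum.inl l'') (Sum.inr μ) := by
    funext μ z l'' w'
    exact BalabanCompositeJets.respStep_eq Lc j μ z l'' w'
  rw [e]

end Family

/-! ## §4 (v2) The base of the family: at `j = 0` the decimated-composite stencil IS an2's composite stencil -/

section Base

variable {d Lc : ℕ} [NeZero Lc]

/-- [folklore] **THE CHAIN RULE THROUGH THE TRIVIAL MINIMISER IS THE IDENTITY**: at blocking factor `1` the one-shot chain-rule vertex of a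
stencil family is the family itself (`ResolventComposition.wH_one`: `ℋ_1 = 𝟙`). -/
theorem vertexOf_of_eq_one {N : ℕ} [NeZero N] (hN : N = 1) (S : Fin (d + 1) → (Fin (d + 1) → ℤ) → MKer (d + 1) (Fib d))
    (κ : Fin (d + 1)) (u : Fin (d + 1) → ℤ) : vertexOf (N := N) S κ u = S κ u := by
  funext x z a b
  show ∑ κ' : Fin (d + 1), OneStepResolventKernel.wsum
      (fun u' => KernelSpecInstance.wH (N := N) κ' κ (u' - (N : ℤ) • u)) (S κ') x z a b = S κ u x z a b
  have hw : ∀ κ' u', KernelSpecInstance.wH (N := N) κ' κ (u' - (N : ℤ) • u) = if u' = u ∧ κ' = κ then 1 else 0 := by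
    intro κ' u'
    rw [ResolventComposition.wH_one hN, hN]
    simp only [Nat.cast_one, one_smul, sub_eq_zero]
  simp only [OneStepResolventKernel.wsum, hw, ite_mul, one_mul, zero_mul]
  have hin : ∀ κ', (∑' u' : Fin (d + 1) → ℤ, if u' = u ∧ κ' = κ then S κ' u' x z a b else 0) =
      if κ' = κ then S κ' u x z a b else 0 := by
    intro κ'
    by_cases hk : κ' = κ
    · simp only [hk, and_true, if_true]
      exact tsum_ite_eq u (fun u' => S κ u' x z a b)
    · simp only [hk, and_false, if_false, tsum_zero]
  simp only [hin, Finset.sum_ite_eq', Finset.mem_univ, if_true]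

/-- [folklore] **THE BASE OF THE FAMILY**: `SDec … 0 m = Sc … m` — at `j = 0` (no decimation, trivial response) the (0, m) member IS an2's
one-shot composite stencil of the `(m+1)`-fold step (`BalabanCompositeJets.Sc … m`, the first-order part of `jcOf … (m+1)`); so `SDec` is a
genuine extension of the composite family to the step-`j` lattices, indexed as announced (member `m` ↔ the `(m+1)`-fold step). -/
theorem SDec_zero_level (cE cVH cΛ : ℝ) (m : ℕ) : SDec d Lc cE cVH cΛ 0 m = Sc d Lc cE cVH cΛ m := by
  funext κ u
  rw [SDec_apply, vertexOf_of_eq_one (pow_zero Lc), pow_zero, HessianTelescopingKKT.dec_one, Nat.zero_add]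
  simp

end Base

end Summit.QuantumFields.BalabanUV.Beta.FP.StationarityJ
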